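import Literature.NumberTheory.EllipticCurves.CasselsTateGeneralCase
import Literature.NumberTheory.EllipticCurves.CasselsTateLemma617
import HarnessLib

/-!
# The general case of the Cassels–Tate pairing at level `m`: the kernel on `Ш[m]` is `Ш[m] ∩ mШ`

Topic `NumberTheory/EllipticCurves`; namespace `Literature.NumberTheory.EllipticCurves`. One auxiliary
structure (`PTChoice`, admissible cochain choices computing the Poitou–Tate pairing
`Ш²(K, E[m]) × Ш¹(K, E[m]) → ℤ/m²` through the descended pairing `E[m] × E[m] → μ_{m²}`), definitions with
bodies and theorems only: **no named fact is introduced** (D-0026). The non-elliptic inputs of Milne's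
proof of Thm. 6.13(a) enter as explicit, honest hypotheses (never as named facts), in the conventions of
`CasselsTateGeneralCase.lean`:

* `halt` (the Weil pairing is alternating), `hPT' : inv.SumInvLocalizationEqZero` (reciprocity for
  `H²(K, μ_{m²})`), `hH3` (`Ш³(K, μ_{m²}) = 0`, Milne I 4.10(c)/4.21) — as in `CasselsTateGeneralCase`;
* `hfin` — every general-case datum has finitely supported local terms (Milne works with `G_S`-cochains;
  here: all the global cochains factor through finite Galois groups and `H²(K_v^{nr}/K_v, μ) = 0`);
* `hPTc` — **Poitou–Tate for `Ш²(K, E[m])`** (Milne I Thm. 4.10: `Ш²_S(K, A_m) ≅ Ш¹_S(K, Aᵗ_m)^*`, the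
  "third vertical arrow" of the diagram on p. 88) in cochain form: a `2`-cocycle `f` of `E[m]` such that,
  against every locally trivial `1`-cocycle `g` of `E[m]`, some admissible choice of cochains computes
  the value `0` for the Poitou–Tate pairing `⟨[f], [g]⟩`, has class `[f] = 0`;
* `h615` — the conclusion of Lemma 6.15 for all finite `S ⊇ S₀` (as in `CasselsTateLemma617.lean`; it is
  `CasselsTateLemma615.forall_mem_selmerGroup_sumPairing_eq_zero_iff` under that file's hypotheses).

## What is formalised (Milne, *ADT* I, Lemma 6.16, Lemma 6.17 and the proof of Thm. 6.13(a), pp. 87–88)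

For `a ∈ Ш(E/K)[m]` with general-case data `D` (`CasselsTateGeneralCase.GeneralCaseData`):

* `GeneralCaseData.twoCocycleClass_f_eq_zero` — if `⟨a, a'⟩ = 0` for all `a' ∈ Ш(E/K)[m]` then the
  obstruction class `[f] = δ b ∈ H²(K, E[m])` vanishes: for a locally trivial `g`, the value `⟨a, [g]⟩`
  computed with the data `(β, β₁, f, κ; g, ε_g)` IS an admissible cochain expression for the Poitou–Tate
  pairing `⟨[f], [g]⟩` (`φ_v = α⁰_v = ι⁻¹(β_{1,v} - κ_v)`, `dα⁰_v = f_v`; `h = ε_g`), so `hPTc` applies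
  (this is the commutativity of the right-hand square of Milne's diagram, p. 88, and Lemma 6.16);
* `GeneralCaseData.exists_map_mulK_eq_of_twoCocycleClass_f_eq_zero` — `[f] = 0` gives `f = dα` and the
  COCYCLE `β₁ - ι ∘ α` lifting `β` along `[m]`: `b ∈ [m]_* H¹(K, E[m²])`, i.e. `a ∈ m H¹(K, E)` (Milne's
  `a ∈ Ш'(K, A)`, Lemma 6.16);
* `exists_mem_sha_smul_eq_of_forall_ctGeneralFun_eq_zero` — **the kernel theorem**: `a ∈ Ш[m]`
  orthogonal to `Ш[m]` under `ctGeneralFun` lies in `m Ш(E/K)` (first case by the two previous steps,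
  `ctGeneralFun = ctFirstCaseFun` there by `ctGeneralFun_eq_ctFirstCaseFun`, then Lemma 6.17,
  `exists_mem_sha_smul_eq_of_forall_ctFirstCaseFun_eq_zero`);
* the easy converse `ctGeneralFun_eq_zero_of_exists_mem_sha_smul_eq` and the iff
  `exists_mem_sha_smul_eq_iff_forall_ctGeneralFun_eq_zero` (Milne I Thm. 6.13(a) at level `m` for the
  left kernel, modulo the listed inputs); bi-additivity on `Ш[m] × Ш[m]` (`ctGeneralFun_add_left_of_mem_sha`,
  `ctGeneralFun_add_right_of_mem_sha`).

## References

* [MilneADT2006] J. S. Milne, *Arithmetic Duality Theorems*, 2nd ed. (2006), Ch. I §6, Prop. 6.9 (general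
  case of the definition, p. 79), Lemma 6.16, Lemma 6.17, proof of Thm. 6.13(a) (pp. 87–88); Thm. 4.10.
-/

noncomputable section

open scoped Classical

universe u

namespace Literature.NumberTheory.EllipticCurves

open CategoryTheory _root_.WeierstrassCurve Field Function NumberField
open Literature.NumberTheory.GaloisRepresentations Literature.NumberTheory.GaloisCohomology
open Literature.NumberTheory.GaloisRepresentations.DiscreteGaloisModule (mu MuCarrier pairing)
open scoped ContRepresentation

-- Cup products need `LocallyCompactSpace Γ`; as in the tree's cup-product files, the compactness of
-- absolute Galois groups is a local instance only.
attribute [local instance] absoluteGaloisGroup_compactSpace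

-- `char K_v = 0` for the completions of a number field (the tree's theorem `charZero_placeCompletion`;
-- local instance, no override).
attribute [local instance] charZero_placeCompletion

variable {K : Type u} [Field K] [NumberField K] (W : WeierstrassCurve K) (m : ℕ) [NeZero m]
variable (e : geomTorsion W ((m * m : ℕ) : ℤ) → geomTorsion W ((m * m : ℕ) : ℤ) → AlgebraicClosure K)
  (hμ : ∀ S T, e S T ^ (m * m) = 1)
  (hadd₁ : ∀ S₁ S₂ T, e (S₁ + S₂) T = e S₁ T * e S₂ T)
  (hadd₂ : ∀ S T₁ T₂, e S (T₁ + T₂) = e S T₁ * e S T₂)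
  (hgal : ∀ (σ : absoluteGaloisGroup K) (S T : geomTorsion W ((m * m : ℕ) : ℤ)),
    σ • e S T = e (σ • S) (σ • T))

/-! ## Admissible cochain choices for the Poitou–Tate pairing `Ш²(K, E[m]) × Ш¹(K, E[m]) → ℤ/m²` -/

/-- **Admissible cochain choices computing the Poitou–Tate pairing `⟨[f], [g]⟩`** of a `2`-cocycle `f`
and a `1`-cocycle `g` of `E[m]` through the descended pairing `E[m] × E[m] → μ_{m²}` (Milne, *ADT*, I §4,
the pairing `Ш²_S(K, M) × Ш¹_S(K, M^D) → ℚ/ℤ` of Thm. 4.10, written with cochains exactly as the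
Cassels–Tate pairing of Prop. 6.9): a global `2`-cochain `h` of `μ_{m²}` with `dh = f ∪ g`, and at every
place `v` a local `1`-cochain `φ_v` of `E[m]` with `dφ_v = f_v` (so `[f]` is locally trivial); the value is
`∑_v inv_v [φ_v ∪ g_v - h_v]` (`PTChoice.localTerm`). [cite: MilneADT2006, Ch. I §4 Thm. 4.10 and §6, proof of Thm. 6.13(a), p. 88] -/
structure PTChoice (f : contTwoCocycles (W.torsionGaloisModule (m : ℤ)).toTopRep)
    (g : contOneCocycles (W.torsionGaloisModule (m : ℤ)).toTopRep) where
  /-- the global `2`-cochain `h` with `dh = f ∪_desc g` -/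
  h : C(absoluteGaloisGroup K × absoluteGaloisGroup K, MuCarrier K (m * m))
  dTwo_h : ∀ σ τ υ : absoluteGaloisGroup K,
    ((descendPairing W m m e hμ hadd₁ hadd₂ hgal).cupCocycle₂₁ f g).1 (σ, τ, υ) = dTwo (mu K (m * m)).toTopRep h σ τ υ
  /-- the local primitives `φ_v` of `f`: `dφ_v = f_v` -/
  φ : (v : Place K) → C(absoluteGaloisGroup (Place.Completion v), torsionRepAt W (Place.Completion v) (m : ℤ))
  dOne_φ : ∀ (v : Place K) (σ τ : absoluteGaloisGroup (Place.Completion v)),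
    (resTwo (W.torsionGaloisModule (m : ℤ)) (Place.Completion v) f).1 (σ, τ) =
      (torsionRepAt W (Place.Completion v) (m : ℤ)).ρ σ (φ v τ) - φ v (σ * τ) + φ v σ

namespace PTChoice

variable {W m e hμ hadd₁ hadd₂ hgal}
variable {f : contTwoCocycles (W.torsionGaloisModule (m : ℤ)).toTopRep}
  {g : contOneCocycles (W.torsionGaloisModule (m : ℤ)).toTopRep} (C : PTChoice W m e hμ hadd₁ hadd₂ hgal f g)

/-- `d(h_v) = f_v ∪ g_v` for the restrictions to `Γ_v`. [folklore] -/
theorem dTwo_res (v : Place K) (σ τ υ : absoluteGaloisGroup (Place.Completion v)) :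
    (((descendPairing W m m e hμ hadd₁ hadd₂ hgal).restrict (absGaloisRestrict K (Place.Completion v))).cupCocycle₂₁
        (resTwo (W.torsionGaloisModule (m : ℤ)) (Place.Completion v) f)
        (resOne (W.torsionGaloisModule (m : ℤ)) (Place.Completion v) g)).1 (σ, τ, υ) =
      dTwo (muRepAt (K := K) m (Place.Completion v)) (resCochain₂ (Place.Completion v) C.h) σ τ υ := by
  have h := C.dTwo_h (absGaloisRestrict K (Place.Completion v) σ) (absGaloisRestrict K (Place.Completion v) τ)
    (absGaloisRestrict K (Place.Completion v) υ)
  rw [ContPairing.cupCocycle₂₁_apply, dTwo_apply] at h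
  rw [ContPairing.cupCocycle₂₁_apply, dTwo_apply, ContPairing.restrict_toLin, resTwo_apply, resOne_apply,
    resOne_apply, resCochain₂_apply, resCochain₂_apply, resCochain₂_apply, resCochain₂_apply]
  simp only [map_mul (absGaloisRestrict K (Place.Completion v))]
  exact h

/-- **The local `2`-cocycle `φ_v ∪_desc g_v - h_v`** of the choice at `v` (the tree's `cupSubCocycle`).
[cite: MilneADT2006, Ch. I §4, Thm. 4.10] -/
def localCocycle (v : Place K) : contTwoCocycles (muRepAt (K := K) m (Place.Completion v)) :=
  ((descendPairing W m m e hμ hadd₁ hadd₂ hgal).restrict (absGaloisRestrict K (Place.Completion v))).cupSubCocycle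
    (C.φ v) (resOne (W.torsionGaloisModule (m : ℤ)) (Place.Completion v) g)
    (resTwo (W.torsionGaloisModule (m : ℤ)) (Place.Completion v) f) (C.dOne_φ v)
    (resCochain₂ (Place.Completion v) C.h) (C.dTwo_res v)

/-- **The local term `inv_v [φ_v ∪_desc g_v - h_v]`** of the choice at `v`. [cite: MilneADT2006, Ch. I §4, Thm. 4.10] -/
def localTerm (inv : LocalInvariants K (m * m)) (v : Place K) : ZMod (m * m) :=
  inv v (locClass₂ (mu K (m * m)) (Place.Completion v) (C.localCocycle v))

end PTChoice

namespace GeneralCaseData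

variable {W m e hμ hadd₁ hadd₂ hgal}
variable (inv : LocalInvariants K (m * m)) (D : GeneralCaseData W m e hμ hadd₁ hadd₂ hgal)

/-- **The data of the Cassels–Tate pairing ARE an admissible choice for the Poitou–Tate pairing
`⟨[f], [β']⟩`**: `h = ε`, `φ_v = α⁰_v = ι⁻¹ ∘ (β_{1,v} - κ_v)` (`dα⁰_v = f_v`,
`KummerLocalData.f_eq_dOne_alpha`). [cite: MilneADT2006, Ch. I §6, proof of Thm. 6.13(a), p. 88] -/
def ptChoice : PTChoice W m e hμ hadd₁ hadd₂ hgal D.f D.β' where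
  h := D.ε
  dTwo_h := D.dTwo_ε
  φ v := (D.localData v).alpha
  dOne_φ v := (D.localData v).f_eq_dOne_alpha

/-- The local terms of the data are those of the associated Poitou–Tate choice (definitionally: both are
`inv_v [α⁰_v ∪_desc β'_v - ε_v]`). [cite: MilneADT2006, Ch. I §6, proof of Thm. 6.13(a), p. 88] -/
theorem ptChoice_localTerm (v : Place K) : D.ptChoice.localTerm inv v = D.localTerm inv v := rfl

/-! ## Changing the second argument of the data -/

/-- **A `2`-cochain `ε` with `dε = f ∪_desc g` exists for every `1`-cocycle `g`**, granted
`Ш³(K, μ_{m²}) = 0` (`hH3`): `f ∪ g` is a coboundary at every place (`d(α⁰_v ∪ g_v) = f_v ∪ g_v`,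
`KummerLocalData.threeCocycleClass_cupCocycle₂₁_eq_zero`). [cite: MilneADT2006, Ch. I §6, proof of Prop. 6.9] -/
theorem exists_eps [W.IsElliptic]
    (hH3 : ∀ c : galoisCohomology (mu K (m * m)) 3,
      (∀ v : Place K, galoisCohomology.localization (mu K (m * m)) v 3 c = 0) → c = 0)
    (g : contOneCocycles (W.torsionGaloisModule (m : ℤ)).toTopRep) :
    ∃ ε : C(absoluteGaloisGroup K × absoluteGaloisGroup K, MuCarrier K (m * m)), ∀ σ τ υ : absoluteGaloisGroup K,
      ((descendPairing W m m e hμ hadd₁ hadd₂ hgal).cupCocycle₂₁ D.f g).1 (σ, τ, υ) =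
        dTwo (mu K (m * m)).toTopRep ε σ τ υ := by
  have hz : threeCocycleClass _ ((descendPairing W m m e hμ hadd₁ hadd₂ hgal).cupCocycle₂₁ D.f g) = 0 := by
    refine hH3 _ fun v => ?_
    have hzz : resThree (mu K (m * m)) (Place.Completion v)
          ((descendPairing W m m e hμ hadd₁ hadd₂ hgal).cupCocycle₂₁ D.f g) =
        ((descendPairing W m m e hμ hadd₁ hadd₂ hgal).restrict (absGaloisRestrict K (Place.Completion v))).cupCocycle₂₁
          (resTwo (W.torsionGaloisModule (m : ℤ)) (Place.Completion v) D.f)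
          (resOne (W.torsionGaloisModule (m : ℤ)) (Place.Completion v) g) :=
      Subtype.ext (ContinuousMap.ext fun p => by
        obtain ⟨σ, τ, υ⟩ := p
        rw [resThree_apply, ContPairing.cupCocycle₂₁_apply, ContPairing.cupCocycle₂₁_apply,
          ContPairing.restrict_toLin, resTwo_apply, resOne_apply, resOne_apply]
        simp only [map_mul (absGaloisRestrict K (Place.Completion v))])
    have key : threeCocycleClass (muRepAt (K := K) m (Place.Completion v))
        (resThree (mu K (m * m)) (Place.Completion v)
          ((descendPairing W m m e hμ hadd₁ hadd₂ hgal).cupCocycle₂₁ D.f g)) = 0 := by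
      rw [hzz]
      exact (D.localData v).threeCocycleClass_cupCocycle₂₁_eq_zero e hμ hadd₁ hadd₂ hgal _
    rw [threeCocycleClass_resThree] at key
    exact key
  exact (threeCocycleClass_eq_zero_iff_dTwo _ _).1 hz

/-- **The data with a new second argument**: keep `(b, β, β₁, f, κ)` and replace `(b', β', ε)` by
`([g], g, ε)` for a Selmer cocycle `g` and a `2`-cochain `ε` with `dε = f ∪_desc g`. [folklore] -/
def withRight (g : contOneCocycles (W.torsionGaloisModule (m : ℤ)).toTopRep)
    (hg : oneCocycleClass _ g ∈ selmerGroup W (m : ℤ))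
    (ε : C(absoluteGaloisGroup K × absoluteGaloisGroup K, MuCarrier K (m * m)))
    (hε : ∀ σ τ υ : absoluteGaloisGroup K,
      ((descendPairing W m m e hμ hadd₁ hadd₂ hgal).cupCocycle₂₁ D.f g).1 (σ, τ, υ) =
        dTwo (mu K (m * m)).toTopRep ε σ τ υ) :
    GeneralCaseData W m e hμ hadd₁ hadd₂ hgal :=
  { D with b' := oneCocycleClass _ g, b'_mem := hg, β' := g, hβ' := rfl, ε := ε, dTwo_ε := hε }

/-! ## Step 1: orthogonality to `Ш[m]` forces `[f] = 0` (Poitou–Tate for `Ш²(K, E[m])`) -/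

omit [NeZero m] in
/-- A locally trivial `1`-cocycle has a Selmer class (`0 ∈ 𝓛_v`). [folklore] -/
theorem oneCocycleClass_mem_selmerGroup_of_forall_locClass_eq_zero [W.IsElliptic]
    (g : contOneCocycles (W.torsionGaloisModule (m : ℤ)).toTopRep)
    (hg : ∀ v : Place K, locClass (W.torsionGaloisModule (m : ℤ)) (Place.Completion v)
      (resOne (W.torsionGaloisModule (m : ℤ)) (Place.Completion v) g) = 0) :
    oneCocycleClass _ g ∈ selmerGroup W (m : ℤ) :=
  (W.mem_selmerGroup_iff_forall_localization_mem (m : ℤ) _).mpr fun v => by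
    change galoisCohomology.res _ (Place.Completion v) 1 (oneCocycleClass _ g) ∈
      W.kummerLocalConditionAt (m : ℤ) (Place.Completion v)
    rw [← locClass_resOne, hg v]
    exact zero_mem _

omit [NeZero m] in
/-- The image in `H¹(K, E)` of a Selmer class lies in `Ш(E/K)`. [folklore] -/
theorem torsionH1ToH1_mem_sha_of_mem_selmerGroup {b : galoisCohomology (W.torsionGaloisModule (m : ℤ)) 1}
    (hb : b ∈ selmerGroup W (m : ℤ)) : torsionH1ToH1 W (m : ℤ) b ∈ W.sha := by
  have h := hb
  rw [selmerGroup_eq_comap_sha] at h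
  exact h

/-- **Step 1 (Milne, proof of Thm. 6.13(a): Lemma 6.16 and the right-hand square of the diagram on
p. 88).** If `⟨a, a'⟩ = 0` for all `a' ∈ Ш(E/K)[m]`, then `[f] = 0` in `H²(K, E[m])`: against a locally
trivial `1`-cocycle `g` of `E[m]` (its class `[g]` is Selmer, its image `a'` lies in `Ш[m]`), the data
`(b, β, β₁, f, κ; [g], g, ε_g)` (`withRight`, `exists_eps`) compute `⟨a, a'⟩ = 0` AS the value of the
admissible Poitou–Tate choice `(ε_g; α⁰_v)` for `⟨[f], [g]⟩` (`ptChoice_localTerm`), so the Poitou–Tate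
input `hPTc` gives `[f] = 0`. Hypotheses: `halt`, `hPT'`, `hH3`, `hfin`, `hPTc` (module docstring).
[cite: MilneADT2006, Ch. I §6, Lemma 6.16 and proof of Thm. 6.13(a), p. 88] -/
theorem twoCocycleClass_f_eq_zero [W.IsElliptic] (halt : ∀ T, e T T = 1) (hPT' : inv.SumInvLocalizationEqZero)
    (hH3 : ∀ c : galoisCohomology (mu K (m * m)) 3,
      (∀ v : Place K, galoisCohomology.localization (mu K (m * m)) v 3 c = 0) → c = 0)
    (hfin : ∀ D : GeneralCaseData W m e hμ hadd₁ hadd₂ hgal, ∃ S : Finset (Place K), ∀ v ∉ S, D.localTerm inv v = 0)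
    (hPTc : ∀ f : contTwoCocycles (W.torsionGaloisModule (m : ℤ)).toTopRep,
      (∀ g : contOneCocycles (W.torsionGaloisModule (m : ℤ)).toTopRep,
        (∀ v : Place K, locClass (W.torsionGaloisModule (m : ℤ)) (Place.Completion v)
          (resOne (W.torsionGaloisModule (m : ℤ)) (Place.Completion v) g) = 0) →
        ∃ (C : PTChoice W m e hμ hadd₁ hadd₂ hgal f g) (S : Finset (Place K)),
          (∀ v ∉ S, C.localTerm inv v = 0) ∧ ∑ v ∈ S, C.localTerm inv v = 0) →
      twoCocycleClass _ f = 0)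
    (horth : ∀ a' ∈ W.sha, (m : ℤ) • a' = 0 →
      ctGeneralFun W m e hμ hadd₁ hadd₂ hgal inv (torsionH1ToH1 W (m : ℤ) D.b) a' = 0) :
    twoCocycleClass _ D.f = 0 := by
  refine hPTc D.f fun g hg => ?_
  have hgSel := oneCocycleClass_mem_selmerGroup_of_forall_locClass_eq_zero (W := W) (m := m) g hg
  obtain ⟨ε, hε⟩ := D.exists_eps hH3 g
  let D₂ : GeneralCaseData W m e hμ hadd₁ hadd₂ hgal := D.withRight g hgSel ε hε
  obtain ⟨S, hS⟩ := hfin D₂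
  refine ⟨D₂.ptChoice, S, fun v hv => hS v hv, ?_⟩
  show D₂.sumOn inv S = 0
  rw [← ctGeneralFun_eq inv halt hPT' D₂ hS]
  exact horth _ (torsionH1ToH1_mem_sha_of_mem_selmerGroup hgSel) (torsionH1ToH1_mem_torsionBy W (m : ℤ) _)

/-! ## Step 2: `[f] = 0` puts `a` in the first case -/

omit [NumberField K] in
/-- The action of `Γ_K` on `E[n](K̄)` through the `TopRep`. [folklore] -/
theorem toTopRep_ρ_apply (n : ℤ) (σ : absoluteGaloisGroup K) (S : geomTorsion W n) :
    (W.torsionGaloisModule n).toTopRep.ρ σ S = σ • S := rfl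

/-- **Step 2 (Milne, Lemma 6.16: "`a` maps to zero in `H²(G_S, A_m)` iff its image in `H¹(G_S, A)` is
divisible by `m`").** If `[f] = 0`, say `f = dα` for a continuous `1`-cochain `α` of `E[m]`, then
`β₁ - ι ∘ α` is a `1`-COCYCLE of `E[m²]` with `[m] ∘ (β₁ - ι ∘ α) = β`; hence `b = [m]_* b₁` for
`b₁ = [β₁ - ι ∘ α] ∈ H¹(K, E[m²])`, i.e. `a ∈ m H¹(K, E)` (the first case). [cite: MilneADT2006, Ch. I §6, Lemma 6.16] -/
theorem exists_map_mulK_eq_of_twoCocycleClass_f_eq_zero (hf : twoCocycleClass _ D.f = 0) :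
    ∃ b₁ : galoisCohomology (W.torsionGaloisModule ((m * m : ℕ) : ℤ)) 1,
      galoisCohomology.map (mulK W m m) 1 b₁ = D.b := by
  obtain ⟨α, hα⟩ := (twoCocycleClass_eq_zero_iff _ D.f).1 hf
  let ια : C(absoluteGaloisGroup K, geomTorsion W ((m * m : ℕ) : ℤ)) :=
    (⟨inclKD W m m, continuous_of_discreteTopology⟩ :
      C(geomTorsion W (m : ℤ), geomTorsion W ((m * m : ℕ) : ℤ))).comp α
  have hια : ∀ σ, ια σ = inclKD W m m (α σ) := fun σ => rfl
  -- `β₁ - ι ∘ α` is a cocycle: `d(β₁ - ια) = ι f - ι dα = 0`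
  have hcoc : D.β₁ - ια ∈ contOneCocycles (W.torsionGaloisModule ((m * m : ℕ) : ℤ)).toTopRep := fun σ τ => by
    have h1 := D.inclKD_f σ τ
    rw [hα σ τ, toTopRep_ρ_apply, map_add, map_sub, inclKD_smul] at h1
    change D.β₁ (σ * τ) - ια (σ * τ) = (D.β₁ σ - ια σ) + σ • (D.β₁ τ - ια τ)
    rw [hια, hια, hια, smul_sub, ← sub_eq_zero]
    have h2 : D.β₁ (σ * τ) - inclKD W m m (α (σ * τ)) -
        (D.β₁ σ - inclKD W m m (α σ) + (σ • D.β₁ τ - σ • inclKD W m m (α τ))) =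
        -((σ • D.β₁ τ - D.β₁ (σ * τ) + D.β₁ σ) -
          (σ • inclKD W m m (α τ) - inclKD W m m (α (σ * τ)) + inclKD W m m (α σ))) := by
      abel
    rw [h2, ← h1, sub_self, neg_zero]
  refine ⟨oneCocycleClass _ ⟨D.β₁ - ια, hcoc⟩, ?_⟩
  rw [← oneCocycleClass_pushOne, ← D.hβ]
  congr 1
  apply Subtype.ext
  ext σ : 1
  change mulK W m m (D.β₁ σ - ια σ) = D.β.1 σ
  rw [hια, map_sub, D.mulK_β₁, mulK_inclKD, sub_zero]

end GeneralCaseData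

/-! ## The kernel theorem -/

section Kernel

variable {W m e hμ hadd₁ hadd₂ hgal}
variable (inv : LocalInvariants K (m * m))

/-- A class of `Ш(E/K)` killed by `m` has a Selmer lift at level `m` (Kummer sequence). [folklore] -/
theorem exists_selmer_lift [W.IsElliptic] {a : W.galH1} (ha : a ∈ W.sha) (hma : (m : ℤ) • a = 0) :
    ∃ b ∈ selmerGroup W (m : ℤ), torsionH1ToH1 W (m : ℤ) b = a := by
  have hm : (m : ℤ) ≠ 0 := Int.natCast_ne_zero.mpr (NeZero.ne m)
  have har : a ∈ (torsionH1ToH1 W (m : ℤ)).range := by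
    rw [range_torsionH1ToH1_eq_torsionBy_holds W hm]
    exact hma
  obtain ⟨b, hb⟩ : ∃ b, torsionH1ToH1 W (m : ℤ) b = a := har
  refine ⟨b, ?_, hb⟩
  rw [selmerGroup_eq_comap_sha]
  change torsionH1ToH1 W (m : ℤ) b ∈ W.sha
  rw [hb]
  exact ha

-- `hPT'` is the reciprocity predicate `LocalInvariants.SumInvLocalizationEqZero` on `inv`, not a named fact.
variable (halt : ∀ T, e T T = 1) (hPT' : inv.SumInvLocalizationEqZero)
  (hH3 : ∀ c : galoisCohomology (mu K (m * m)) 3,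
    (∀ v : Place K, galoisCohomology.localization (mu K (m * m)) v 3 c = 0) → c = 0)
include halt hPT'

/-- **The easy half** (Milne I Lemma 6.17, first sentence of the proof / the tree's
`ctGeneralFun_eq_zero_of_left`): `⟨m a₀, a'⟩ = 0` for `a₀ ∈ Ш(E/K)` with `m (m a₀) = 0` and `a' ∈ Ш(E/K)[m]`.
[cite: MilneADT2006, Ch. I §6, Lemma 6.17] -/
theorem ctGeneralFun_eq_zero_of_exists_mem_sha_smul_eq [W.IsElliptic] {a a' : W.galH1} (hma : (m : ℤ) • a = 0)
    (hdiv : ∃ a₀ ∈ W.sha, (m : ℤ) • a₀ = a) (ha' : a' ∈ W.sha) (hma' : (m : ℤ) • a' = 0) :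
    ctGeneralFun W m e hμ hadd₁ hadd₂ hgal inv a a' = 0 := by
  have hmm : ((m * m : ℕ) : ℤ) ≠ 0 := Int.natCast_ne_zero.mpr (NeZero.ne (m * m))
  obtain ⟨a₀, ha₀, rfl⟩ := hdiv
  have hm2 : ((m * m : ℕ) : ℤ) • a₀ = 0 := by rw [Nat.cast_mul, mul_zsmul, hma]
  have ha₀r : a₀ ∈ (torsionH1ToH1 W ((m * m : ℕ) : ℤ)).range := by
    rw [range_torsionH1ToH1_eq_torsionBy_holds W hmm]
    exact hm2
  obtain ⟨b₀, hb₀⟩ : ∃ b₀, torsionH1ToH1 W ((m * m : ℕ) : ℤ) b₀ = a₀ := ha₀r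
  have hb₀Sel : b₀ ∈ selmerGroup W ((m * m : ℕ) : ℤ) := by
    rw [selmerGroup_eq_comap_sha]
    change torsionH1ToH1 W ((m * m : ℕ) : ℤ) b₀ ∈ W.sha
    rw [hb₀]
    exact ha₀
  obtain ⟨b', hb'Sel, hb'⟩ := exists_selmer_lift (W := W) (m := m) ha' hma'
  have h := ctGeneralFun_eq_zero_of_left inv (hμ := hμ) (hadd₁ := hadd₁) (hadd₂ := hadd₂) (hgal := hgal) halt hPT'
    hb₀Sel hb'Sel
  rw [torsionH1ToH1_map_mulK, hb₀, hb'] at h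
  exact h

/-- **`⟨a, a'⟩ = ⟨a, a'⟩_{first case}` whenever `a` admits first-case data** (a Selmer lift `b` in the image
of `[m]_*`): packaging of `ctGeneralFun_eq_ctFirstCaseFun` with the construction of first-case data from
`b`, `b₁` and a Selmer lift of `a'` (local lifts by `FirstCaseData.exists_local_lift`).
[cite: MilneADT2006, Ch. I §6, proof of Prop. 6.9] -/
theorem ctGeneralFun_eq_ctFirstCaseFun_of_map_mulK_eq [W.IsElliptic]
    {b : galoisCohomology (W.torsionGaloisModule (m : ℤ)) 1} (hb : b ∈ selmerGroup W (m : ℤ))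
    {b₁ : galoisCohomology (W.torsionGaloisModule ((m * m : ℕ) : ℤ)) 1}
    (hb₁ : galoisCohomology.map (mulK W m m) 1 b₁ = b)
    {b' : galoisCohomology (W.torsionGaloisModule (m : ℤ)) 1} (hb' : b' ∈ selmerGroup W (m : ℤ)) :
    ctGeneralFun W m e hμ hadd₁ hadd₂ hgal inv (torsionH1ToH1 W (m : ℤ) b) (torsionH1ToH1 W (m : ℤ) b') =
      ctFirstCaseFun W m e hμ hadd₁ hadd₂ hgal inv (torsionH1ToH1 W (m : ℤ) b) (torsionH1ToH1 W (m : ℤ) b') := by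
  choose β hβmem hβmap using fun v => FirstCaseData.exists_local_lift (W := W) (m := m) (Place.Completion v)
    ((W.mem_selmerGroup_iff_forall_localization_mem (m : ℤ) b).mp hb v)
  choose β' hβ'mem hβ'map using fun v => FirstCaseData.exists_local_lift (W := W) (m := m) (Place.Completion v)
    ((W.mem_selmerGroup_iff_forall_localization_mem (m : ℤ) b').mp hb' v)
  let D₁ : FirstCaseData W m :=
    { b := b, b_mem := hb, b₁ := b₁, map_b₁ := hb₁, β := β, β_mem := hβmem, map_β := hβmap
      b' := b', b'_mem := hb', β' := β', β'_mem := hβ'mem, map_β' := hβ'map }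
  exact ctGeneralFun_eq_ctFirstCaseFun inv halt hPT' D₁

include hH3 in
/-- **The kernel theorem of the general case** (Milne, *ADT*, I, proof of Thm. 6.13(a): Lemma 6.16,
Lemma 6.17 and the diagram on p. 88, at the fixed level `m`): an `a ∈ Ш(E/K)[m]` with `⟨a, a'⟩ = 0` for
all `a' ∈ Ш(E/K)[m]` (general-case pairing `ctGeneralFun`) is divisible by `m` in `Ш(E/K)`.  Steps: data
`D` for `a` exist (`exists_generalCaseData`, `hH3`); `[f] = 0` (`twoCocycleClass_f_eq_zero`, `hPTc`);
hence `b = [m]_* b₁` (`exists_map_mulK_eq_of_twoCocycleClass_f_eq_zero`), `a = m a₁` is in the first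
case and `⟨a, ·⟩ = ⟨a, ·⟩_{first case}` (`ctGeneralFun_eq_ctFirstCaseFun_of_map_mulK_eq`); conclude by
Lemma 6.17 (`exists_mem_sha_smul_eq_of_forall_ctFirstCaseFun_eq_zero`, inputs `h615`, isotropy from the
discharged fact, `hPT` from `hPT'`). [cite: MilneADT2006, Ch. I §6, Lemma 6.17 and proof of Thm. 6.13(a), pp. 87–88] -/
theorem exists_mem_sha_smul_eq_of_forall_ctGeneralFun_eq_zero [W.IsElliptic]
    (hfin : ∀ D : GeneralCaseData W m e hμ hadd₁ hadd₂ hgal, ∃ S : Finset (Place K), ∀ v ∉ S, D.localTerm inv v = 0)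
    (hPTc : ∀ f : contTwoCocycles (W.torsionGaloisModule (m : ℤ)).toTopRep,
      (∀ g : contOneCocycles (W.torsionGaloisModule (m : ℤ)).toTopRep,
        (∀ v : Place K, locClass (W.torsionGaloisModule (m : ℤ)) (Place.Completion v)
          (resOne (W.torsionGaloisModule (m : ℤ)) (Place.Completion v) g) = 0) →
        ∃ (C : PTChoice W m e hμ hadd₁ hadd₂ hgal f g) (S : Finset (Place K)),
          (∀ v ∉ S, C.localTerm inv v = 0) ∧ ∑ v ∈ S, C.localTerm inv v = 0) →
      twoCocycleClass _ f = 0)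
    (S₀ : Finset (Place K))
    (h615 : ∀ S : Finset (Place K), S₀ ⊆ S → ∀ x : LocalClasses W m S,
      (∀ b' ∈ selmerGroup W (m : ℤ), sumPairing W m e hμ hadd₁ hadd₂ hgal inv S x (locS W m S b') = 0) →
        ∃ b₀ ∈ kummerOutside W m S, ∀ v : S,
          x v - locS W m S b₀ v ∈ W.kummerLocalConditionAt (m : ℤ) (Place.Completion (v : Place K)))
    {a : W.galH1} (ha : a ∈ W.sha) (hma : (m : ℤ) • a = 0)
    (horth : ∀ a' ∈ W.sha, (m : ℤ) • a' = 0 → ctGeneralFun W m e hμ hadd₁ hadd₂ hgal inv a a' = 0) :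
    ∃ a₀ ∈ W.sha, (m : ℤ) • a₀ = a := by
  -- a Selmer lift `b` of `a` and data `D` for `a`
  obtain ⟨b, hbSel, hb⟩ := exists_selmer_lift (W := W) (m := m) ha hma
  obtain ⟨D, hDb, -⟩ := GeneralCaseData.exists_generalCaseData (e := e) (hμ := hμ) (hadd₁ := hadd₁)
    (hadd₂ := hadd₂) (hgal := hgal) hH3 hbSel hbSel
  -- Step 1: `[f] = 0`
  have hf0 : twoCocycleClass _ D.f = 0 :=
    D.twoCocycleClass_f_eq_zero inv halt hPT' hH3 hfin hPTc (by rw [hDb, hb]; exact horth)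
  -- Step 2: `b = [m]_* b₁`, so `a = m a₁` with `a₁` the image of `b₁`
  obtain ⟨b₁, hb₁⟩ := D.exists_map_mulK_eq_of_twoCocycleClass_f_eq_zero hf0
  rw [hDb] at hb₁
  have ha₁ : (m : ℤ) • torsionH1ToH1 W ((m * m : ℕ) : ℤ) b₁ = a := by
    rw [← torsionH1ToH1_map_mulK, hb₁, hb]
  -- Step 3: Lemma 6.17 in the first case, `⟨a, ·⟩_{first case} = ⟨a, ·⟩ = 0` on `Ш[m]`
  refine exists_mem_sha_smul_eq_of_forall_ctFirstCaseFun_eq_zero inv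
    (GeneralCaseData.hiso_of_fact (W := W) (m := m) (e := e) (hμ := hμ) (hadd₁ := hadd₁) (hadd₂ := hadd₂)
      (hgal := hgal) halt)
    (LocalInvariants.sumLocalTermEqZero_of_sumInvLocalizationEqZero inv hPT') S₀ h615 ha hma ha₁
    fun a' ha' hma' => ?_
  obtain ⟨b', hb'Sel, hb'⟩ := exists_selmer_lift (W := W) (m := m) ha' hma'
  have key := ctGeneralFun_eq_ctFirstCaseFun_of_map_mulK_eq inv (hμ := hμ) (hadd₁ := hadd₁) (hadd₂ := hadd₂)
    (hgal := hgal) halt hPT' hbSel hb₁ hb'Sel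
  rw [hb, hb'] at key
  rw [← key]
  exact horth a' ha' hma'

include hH3 in
/-- **Milne I Thm. 6.13(a) at level `m` for the left kernel (general case), as an iff**: for
`a ∈ Ш(E/K)[m]`, `a ∈ m Ш(E/K)` iff `⟨a, a'⟩ = 0` for all `a' ∈ Ш(E/K)[m]` — modulo the inputs `halt`,
`hPT'`, `hH3`, `hfin`, `hPTc`, `h615` of the module docstring. This is the kernel clause of the tree's
`IsLevelPairing` for the general-case pairing. [cite: MilneADT2006, Ch. I §6, Thm. 6.13(a) (proof, pp. 87–88)] -/
theorem exists_mem_sha_smul_eq_iff_forall_ctGeneralFun_eq_zero [W.IsElliptic]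
    (hfin : ∀ D : GeneralCaseData W m e hμ hadd₁ hadd₂ hgal, ∃ S : Finset (Place K), ∀ v ∉ S, D.localTerm inv v = 0)
    (hPTc : ∀ f : contTwoCocycles (W.torsionGaloisModule (m : ℤ)).toTopRep,
      (∀ g : contOneCocycles (W.torsionGaloisModule (m : ℤ)).toTopRep,
        (∀ v : Place K, locClass (W.torsionGaloisModule (m : ℤ)) (Place.Completion v)
          (resOne (W.torsionGaloisModule (m : ℤ)) (Place.Completion v) g) = 0) →
        ∃ (C : PTChoice W m e hμ hadd₁ hadd₂ hgal f g) (S : Finset (Place K)),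
          (∀ v ∉ S, C.localTerm inv v = 0) ∧ ∑ v ∈ S, C.localTerm inv v = 0) →
      twoCocycleClass _ f = 0)
    (S₀ : Finset (Place K))
    (h615 : ∀ S : Finset (Place K), S₀ ⊆ S → ∀ x : LocalClasses W m S,
      (∀ b' ∈ selmerGroup W (m : ℤ), sumPairing W m e hμ hadd₁ hadd₂ hgal inv S x (locS W m S b') = 0) →
        ∃ b₀ ∈ kummerOutside W m S, ∀ v : S,
          x v - locS W m S b₀ v ∈ W.kummerLocalConditionAt (m : ℤ) (Place.Completion (v : Place K)))
    {a : W.galH1} (ha : a ∈ W.sha) (hma : (m : ℤ) • a = 0) :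
    (∃ a₀ ∈ W.sha, (m : ℤ) • a₀ = a) ↔
      ∀ a' ∈ W.sha, (m : ℤ) • a' = 0 → ctGeneralFun W m e hμ hadd₁ hadd₂ hgal inv a a' = 0 :=
  ⟨fun hdiv _ ha' hma' => ctGeneralFun_eq_zero_of_exists_mem_sha_smul_eq inv halt hPT' hma hdiv ha' hma',
    exists_mem_sha_smul_eq_of_forall_ctGeneralFun_eq_zero inv halt hPT' hH3 hfin hPTc S₀ h615 ha hma⟩

/-! ## Bi-additivity on `Ш[m] × Ш[m]` -/

include hH3 in
/-- **Additivity in the first variable on `Ш(E/K)[m]`** (data exist by `exists_generalCaseData`, finite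
supports by `hfin`). [cite: MilneADT2006, Ch. I §6, Prop. 6.9] -/
theorem ctGeneralFun_add_left_of_mem_sha [W.IsElliptic]
    (hfin : ∀ D : GeneralCaseData W m e hμ hadd₁ hadd₂ hgal, ∃ S : Finset (Place K), ∀ v ∉ S, D.localTerm inv v = 0)
    {a₁ a₂ a' : W.galH1} (ha₁ : a₁ ∈ W.sha) (hma₁ : (m : ℤ) • a₁ = 0) (ha₂ : a₂ ∈ W.sha) (hma₂ : (m : ℤ) • a₂ = 0)
    (ha' : a' ∈ W.sha) (hma' : (m : ℤ) • a' = 0) :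
    ctGeneralFun W m e hμ hadd₁ hadd₂ hgal inv (a₁ + a₂) a' =
      ctGeneralFun W m e hμ hadd₁ hadd₂ hgal inv a₁ a' + ctGeneralFun W m e hμ hadd₁ hadd₂ hgal inv a₂ a' := by
  obtain ⟨b₁, hb₁Sel, rfl⟩ := exists_selmer_lift (W := W) (m := m) ha₁ hma₁
  obtain ⟨b₂, hb₂Sel, rfl⟩ := exists_selmer_lift (W := W) (m := m) ha₂ hma₂
  obtain ⟨b', hb'Sel, rfl⟩ := exists_selmer_lift (W := W) (m := m) ha' hma'
  obtain ⟨D, hDb, hDb'⟩ := GeneralCaseData.exists_generalCaseData (e := e) (hμ := hμ) (hadd₁ := hadd₁)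
    (hadd₂ := hadd₂) (hgal := hgal) hH3 hb₁Sel hb'Sel
  obtain ⟨D₂, hD₂b, hD₂b'⟩ := GeneralCaseData.exists_generalCaseData (e := e) (hμ := hμ) (hadd₁ := hadd₁)
    (hadd₂ := hadd₂) (hgal := hgal) hH3 hb₂Sel hb'Sel
  obtain ⟨S₁, hS₁⟩ := hfin D
  obtain ⟨S₂, hS₂⟩ := hfin D₂
  have hS : ∀ v ∉ S₁ ∪ S₂, D.localTerm inv v = 0 := fun v hv => hS₁ v fun h => hv (Finset.mem_union_left _ h)
  have hS' : ∀ v ∉ S₁ ∪ S₂, D₂.localTerm inv v = 0 := fun v hv => hS₂ v fun h => hv (Finset.mem_union_right _ h)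
  have h := ctGeneralFun_add_left inv halt hPT' D D₂ (by rw [hDb', hD₂b']) hS hS'
  rw [hDb, hD₂b, hDb', hD₂b'] at h
  exact h

include hH3 in
/-- **Additivity in the second variable on `Ш(E/K)[m]`.** [cite: MilneADT2006, Ch. I §6, Prop. 6.9] -/
theorem ctGeneralFun_add_right_of_mem_sha [W.IsElliptic]
    (hfin : ∀ D : GeneralCaseData W m e hμ hadd₁ hadd₂ hgal, ∃ S : Finset (Place K), ∀ v ∉ S, D.localTerm inv v = 0)
    {a a'₁ a'₂ : W.galH1} (ha : a ∈ W.sha) (hma : (m : ℤ) • a = 0) (ha'₁ : a'₁ ∈ W.sha) (hma'₁ : (m : ℤ) • a'₁ = 0)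
    (ha'₂ : a'₂ ∈ W.sha) (hma'₂ : (m : ℤ) • a'₂ = 0) :
    ctGeneralFun W m e hμ hadd₁ hadd₂ hgal inv a (a'₁ + a'₂) =
      ctGeneralFun W m e hμ hadd₁ hadd₂ hgal inv a a'₁ + ctGeneralFun W m e hμ hadd₁ hadd₂ hgal inv a a'₂ := by
  obtain ⟨b, hbSel, rfl⟩ := exists_selmer_lift (W := W) (m := m) ha hma
  obtain ⟨b'₁, hb'₁Sel, rfl⟩ := exists_selmer_lift (W := W) (m := m) ha'₁ hma'₁
  obtain ⟨b'₂, hb'₂Sel, rfl⟩ := exists_selmer_lift (W := W) (m := m) ha'₂ hma'₂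
  obtain ⟨D, hDb, hDb'⟩ := GeneralCaseData.exists_generalCaseData (e := e) (hμ := hμ) (hadd₁ := hadd₁)
    (hadd₂ := hadd₂) (hgal := hgal) hH3 hbSel hb'₁Sel
  obtain ⟨D₂, hD₂b, hD₂b'⟩ := GeneralCaseData.exists_generalCaseData (e := e) (hμ := hμ) (hadd₁ := hadd₁)
    (hadd₂ := hadd₂) (hgal := hgal) hH3 hbSel hb'₂Sel
  obtain ⟨S₁, hS₁⟩ := hfin D
  obtain ⟨S₂, hS₂⟩ := hfin D₂
  have hS : ∀ v ∉ S₁ ∪ S₂, D.localTerm inv v = 0 := fun v hv => hS₁ v fun h => hv (Finset.mem_union_left _ h)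
  have hS' : ∀ v ∉ S₁ ∪ S₂, D₂.localTerm inv v = 0 := fun v hv => hS₂ v fun h => hv (Finset.mem_union_right _ h)
  have h := ctGeneralFun_add_right inv halt hPT' D D₂ (by rw [hDb, hD₂b]) hS hS'
  rw [hDb, hD₂b, hDb', hD₂b'] at h
  exact h

end Kernel

end Literature.NumberTheory.EllipticCurves

end
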